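import Mathlib
import Summits.KontsevichZagierPeriods.Zeta5Search.WedgeDictionaryClosing
import Summits.KontsevichZagierPeriods.Zeta5Search.WedgeDictionaryDescent22Mirror
import Summits.KontsevichZagierPeriods.Zeta5Search.WedgeDictionaryDescent22
import Summits.KontsevichZagierPeriods.Zeta5Search.WedgeDictionaryQuadratic
import Summits.KontsevichZagierPeriods.Zeta5Search.WedgeDictionaryForms
import Summits.KontsevichZagierPeriods.Zeta5Search.WedgeDictionaryGhostRay
import Summits.KontsevichZagierPeriods.Zeta5Search.WedgeDictionaryAnchor
import Summits.KontsevichZagierPeriods.Zeta5Search.Elimination.CellularThin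
import Summits.KontsevichZagierPeriods.Zeta5Search.InvarianceOfConverges
import HarnessLib

/-!
# Consequences of the closed wedge dictionary: the remaining obligation nodes and the conditional corollaries,
# hypothesis-free (cell `pub-zeta5`, seat ct-1 g22)

HONEST FRAMING: systematic search; no irrationality claim unless certified.  MODUS PONENS ONLY over landed theorems: ct-1 g21's
`WedgeDictionaryClosing` (`explicitPQ_holds`, `wedgeDictionary_holds`, `I_init_holds`, `I_solvesRec_holds`) and ct-1 g10–g13's
`InvarianceOfConverges.invariance_of_converges'_holds`, fed into implications that were already in the tree with those statements
as HYPOTHESES.  No integral is evaluated here, no new node is minted, no `def`; nothing about `ζ(5)`, no `γ`, no denominator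
statement; records in print unmoved.

1. **Obligation nodes discharged** (internally minted `@[conjecture]` statements of the dictionary lineage, each a typed consequence
   of `explicitPQ`): `WedgeDictionary.fourTermContiguity` (gen-1 g13; `fourTermContiguity_of_explicitPQ`), `phatPartResidue`
   (gen-1 g10; `phatPart_of_explicitPQ`), `phatPartResidueLD` (`phatPartLD_of_explicitPQ`), `phatPartResidueLDMirror`
   (`phatPartLDMirror_of_LD` + (27) at `i₁`).
2. **Hypothesis schemas of the elimination architecture** (`Elimination.CellStarZero`, `CellPencilSlot s`, `TerminalValues`) hold.
3. **Conditional corollaries made unconditional**: Brown–Zudilin's decomposition (5) `I_n = Q_nθ − 4P̂_nζ(2) − 2P_n` for EVERY `n`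
   (the Literature theorem `symmetricDecomposition` took `I_solvesRec`, `I_init`); the diagonal identities of `SymRayExplicitPQ`
   (every partner); `Q(a) = ρ(a)·M₃(b(a))`, the approximating-form identity and bound, and the SHAPE of (4) with leading coefficient
   (17) — all on the dictionary's region; `I(i₁ a) = I(a)` for convergent `a`; `ExplicitPQAt` pointwise on the region and on the
   diagonal / ghost rays.

What this is NOT: the named Literature fact `BrownZudilin2022.decomposition` ((4) on the WHOLE convergence cone) — it stays OPEN:
`decomposition_on_region` below is (4) on the dictionary's half-box region only; nothing analytic; nothing about irrationality.
-/

noncomputable section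

open Finset

namespace Summit.KontsevichZagierPeriods.Zeta5Search.WedgeDictionaryClosingConsequences

open Summit.KontsevichZagierPeriods.Zeta5Search.WedgeDictionary
open Summit.KontsevichZagierPeriods.Zeta5Search.WedgeDictionaryClosing (explicitPQ_holds wedgeDictionary_holds I_init_holds
  I_solvesRec_holds)
open Summit.KontsevichZagierPeriods.Zeta5Search.InvarianceOfConverges (invariance_of_converges'_holds)
open Summit.KontsevichZagierPeriods.Zeta5Search.DualSeries
open Literature.NumberTheory.Irrationality.BrownZudilin2022
open Literature.NumberTheory.Transcendental (zetaValue)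

/-! ## 1. The four obligation nodes -/

/-- **The `@[conjecture]` node `fourTermContiguity` holds**: the DET-form four-term relation on the unit stencils
`(a, a+e₁, a+e₂, a±e_k)` of region points (gen-1 g13), by `fourTermContiguity_of_explicitPQ`. [folklore] -/
theorem fourTermContiguity_holds : fourTermContiguity := fourTermContiguity_of_explicitPQ explicitPQ_holds

/-- **The `@[conjecture]` node `phatPartResidue` holds** (gen-1 g10: the `P̂`-third of the dictionary in Brown–Zudilin's residue
range `p₄ + q₄ ≤ p₃`), by `phatPart_of_explicitPQ`. [folklore] -/
theorem phatPartResidue_holds : phatPartResidue := phatPart_of_explicitPQ explicitPQ_holds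

/-- **The `@[conjecture]` node `phatPartResidueLD` holds** (closed-cone form of the `P̂`-third), by `phatPartLD_of_explicitPQ`.
[folklore] -/
theorem phatPartResidueLD_holds : phatPartResidueLD := phatPartLD_of_explicitPQ explicitPQ_holds

/-- **The `@[conjecture]` node `phatPartResidueLDMirror` holds** (the `P̂`-third on the MIRROR residue range `p₂ + q₂ ≤ p₃`), by the
kernel-checked transport `phatPartLDMirror_of_LD` fed with the theorem (27) at `i₁` (`invariance_of_converges'_holds`). [folklore] -/
theorem phatPartResidueLDMirror_holds : phatPartResidueLDMirror :=
  phatPartLDMirror_of_LD invariance_of_converges'_holds phatPartResidueLD_holds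

/-! ## 2. Pointwise forms and the hypothesis schemas of the elimination architecture -/

/-- `ExplicitPQAt a j` at EVERY region point `(a, j)` (`RegionHyp a j`). [folklore] -/
theorem explicitPQAt_of_regionHyp {a : Fin 8 → ℤ} {j : ℕ} (h : RegionHyp a j) : ExplicitPQAt a j :=
  explicitPQ_iff_at.1 explicitPQ_holds a j h

/-- The cellular STAR relations on the zero-slot strata (`Elimination.CellStarZero`) hold. [folklore] -/
theorem cellStarZero_holds : Elimination.CellStarZero := Elimination.cellStarZero_of_explicitPQ explicitPQ_holds

/-- Every cellular PENCIL slot family (`Elimination.CellPencilSlot s`, `s ∈ [1,7]`) holds. [folklore] -/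
theorem cellPencilSlot_holds {s : ℕ} (hs : s ∈ Icc 1 7) : Elimination.CellPencilSlot s :=
  Elimination.cellPencilSlot_of_explicitPQ explicitPQ_holds hs

/-- The terminal-values schema (`Elimination.TerminalValues`) holds. [folklore] -/
theorem terminalValues_holds : Elimination.TerminalValues := terminal_of_explicitPQ explicitPQ_holds

/-- `ExplicitPQAt` along the whole `{1,6}` two-top (ghost) ray `ghostA n`, partner `2`. [folklore] -/
theorem explicitPQAt_ghostA (n : ℕ) : ExplicitPQAt (ghostA n) 2 := explicitPQAt_ghost_of_explicitPQ explicitPQ_holds n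

/-! ## 3. Brown–Zudilin's decomposition (5) for every `n`, hypothesis-free -/

/-- **Brown–Zudilin 2022, Sect. 2, eq. (5) for EVERY `n`, hypothesis-free**: `I_n = Q_n(2ζ(5) + 4ζ(3)ζ(2)) − 4P̂_nζ(2) − 2P_n`
with `Q_n, P̂_n, P_n` the solutions of the third-order recursion with the printed initial data (`Qsol`, `Phat`, `P`).  The
Literature theorem `symmetricDecomposition` assumed the two named facts `I_solvesRec`, `I_init`; both are tree theorems now.
[folklore] -/
theorem symmetricDecomposition_holds (n : ℕ) :
    Isym n = (Qsol n : ℝ) * zeta5hat - 4 * (Phat n : ℝ) * zetaValue 2 - 2 * (P n : ℝ) :=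
  symmetricDecomposition I_solvesRec_holds I_init_holds n

/-- The same with Brown–Zudilin's explicit binomial sum `Q_n` of (7) (`Q n : ℕ`, `= Qsol n` by `SymmetricRecursion.Q_eq_Qsol`).
[folklore] -/
theorem symmetricDecomposition_holds' (n : ℕ) :
    Isym n = (Q n : ℝ) * zeta5hat - 4 * (Phat n : ℝ) * zetaValue 2 - 2 * (P n : ℝ) := by
  rw [symmetricDecomposition_holds n]
  have h := congrArg (fun q : ℚ => (q : ℝ)) (SymmetricRecursion.Q_eq_Qsol n)
  push_cast at h
  rw [h]

/-- (5) in the `I = 2I′ + 4ζ(2)I″` form, for every `n`: `I_n = 2(Q_nζ(5) − P_n) + 4ζ(2)(Q_nζ(3) − P̂_n)`. [folklore] -/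
theorem Isym_eq_two_I'_add_holds (n : ℕ) :
    Isym n = 2 * ((Qsol n : ℝ) * zetaValue 5 - (P n : ℝ)) + 4 * zetaValue 2 * ((Qsol n : ℝ) * zetaValue 3 - (Phat n : ℝ)) :=
  Isym_eq_two_I'_add I_solvesRec_holds I_init_holds n

/-- `ExplicitPQAt` on the whole diagonal `n·1⁸`, partner `1`, every `n` (also `n = 0`). [folklore] -/
theorem explicitPQAt_aDiag_holds (n : ℕ) : ExplicitPQAt (SymRay.aDiag n) 1 := explicitPQAt_aDiag I_solvesRec_holds I_init_holds n

/-- **`(Q, P̂, P)(n·1⁸)` as the wedge minors, integral form, every `n`**: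
`I(n·1⁸) = ρ_n·[(UW′ − U′W)(2ζ(5) + 4ζ(3)ζ(2)) − 4(UV′ − U′V)ζ(2) − 2(VW′ − V′W)]`, `ρ_n = (−1)ⁿ n!¹⁰/(4(2n)!)`,
`(U, W, V) = (coeffU, coeffW, coeffV)(bRay n)`, primes at `bRay' n` (was conditional on `I_solvesRec`, `I_init`). [folklore] -/
theorem cellularIntegral_diag_minors_holds (n : ℕ) :
    cellularIntegral (SymRay.aDiag n) =
      ((-1) ^ n * (n.factorial : ℝ) ^ 10 / (4 * ((2 * n).factorial : ℝ))) *
        (((coeffU (SymRay.bRay n) : ℝ) * coeffW (SymRay.bRay' n) - coeffU (SymRay.bRay' n) * coeffW (SymRay.bRay n)) *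
            (2 * zetaValue 5 + 4 * zetaValue 3 * zetaValue 2) -
          4 * ((coeffU (SymRay.bRay n) : ℝ) * coeffV (SymRay.bRay' n) - coeffU (SymRay.bRay' n) * coeffV (SymRay.bRay n)) *
            zetaValue 2 -
          2 * ((coeffV (SymRay.bRay n) : ℝ) * coeffW (SymRay.bRay' n) - coeffV (SymRay.bRay' n) * coeffW (SymRay.bRay n))) :=
  SymRay.cellularIntegral_diag_minors I_solvesRec_holds I_init_holds n

/-- The `I′`/`I″` reading on the diagonal, every `n`: `I(n·1⁸) = 2·I′_n + 4ζ(2)·I″_n` with `I′_n = ρ_n(UW′ − U′W)ζ(5) − ρ_n(VW′ − V′W)`,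
`I″_n = ρ_n(UW′ − U′W)ζ(3) − ρ_n(UV′ − U′V)` (was conditional on `I_solvesRec`, `I_init`). [folklore] -/
theorem cellularIntegral_diag_forms_holds (n : ℕ) :
    cellularIntegral (SymRay.aDiag n) =
      2 * (((-1) ^ n * (n.factorial : ℝ) ^ 10 / (4 * ((2 * n).factorial : ℝ))) *
            (((coeffU (SymRay.bRay n) : ℝ) * coeffW (SymRay.bRay' n) - coeffU (SymRay.bRay' n) * coeffW (SymRay.bRay n)) *
                zetaValue 5 -
              ((coeffV (SymRay.bRay n) : ℝ) * coeffW (SymRay.bRay' n) - coeffV (SymRay.bRay' n) * coeffW (SymRay.bRay n)))) +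
        4 * zetaValue 2 * (((-1) ^ n * (n.factorial : ℝ) ^ 10 / (4 * ((2 * n).factorial : ℝ))) *
            (((coeffU (SymRay.bRay n) : ℝ) * coeffW (SymRay.bRay' n) - coeffU (SymRay.bRay' n) * coeffW (SymRay.bRay n)) *
                zetaValue 3 -
              ((coeffU (SymRay.bRay n) : ℝ) * coeffV (SymRay.bRay' n) - coeffU (SymRay.bRay' n) * coeffV (SymRay.bRay n)))) :=
  SymRay.cellularIntegral_diag_forms I_solvesRec_holds I_init_holds n

/-- **The conclusion of `explicitPQ` on the whole diagonal for EVERY partner `j ∈ [1,7]`** (not only the admissible ones), every `n`,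
with `a = n·1⁸`, `b = b(a)`, `b′ = b + e_j` (was conditional on `I_solvesRec`, `I_init`). [folklore] -/
theorem explicitPQ_diag_allj_holds (n : ℕ) (j : ℕ) (hj : j ∈ Icc 1 7) :
    cellularIntegral (SymRay.aDiag n) =
      (QOf (SymRay.aDiag n) : ℝ) * (2 * zetaValue 5 + 4 * zetaValue 3 * zetaValue 2) -
        4 * ((rhoOf (SymRay.aDiag n) *
              (coeffU (bOfA (SymRay.aDiag n)) * coeffV (Function.update (bOfA (SymRay.aDiag n)) j (bOfA (SymRay.aDiag n) j + 1)) -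
                coeffU (Function.update (bOfA (SymRay.aDiag n)) j (bOfA (SymRay.aDiag n) j + 1)) *
                  coeffV (bOfA (SymRay.aDiag n))) : ℚ) : ℝ) * zetaValue 2 -
        2 * ((rhoOf (SymRay.aDiag n) *
              (coeffW (Function.update (bOfA (SymRay.aDiag n)) j (bOfA (SymRay.aDiag n) j + 1)) * coeffV (bOfA (SymRay.aDiag n)) -
                coeffW (bOfA (SymRay.aDiag n)) *
                  coeffV (Function.update (bOfA (SymRay.aDiag n)) j (bOfA (SymRay.aDiag n) j + 1))) : ℚ) : ℝ) :=
  SymRay.explicitPQ_diag_allj I_solvesRec_holds I_init_holds n j hj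

/-- **The conclusion of `wedgeDictionary` on the whole diagonal** (`a = n·1⁸`, `j = 1`), both conjuncts, every `n`
(the integral conjunct was conditional on `I_solvesRec`, `I_init`). [folklore] -/
theorem wedgeDictionary_diag_holds (n : ℕ) :
    (QOf (SymRay.aDiag n) : ℚ) = rhoOf (SymRay.aDiag n) *
        (coeffU (bOfA (SymRay.aDiag n)) * coeffW (Function.update (bOfA (SymRay.aDiag n)) 1 (bOfA (SymRay.aDiag n) 1 + 1)) -
          coeffU (Function.update (bOfA (SymRay.aDiag n)) 1 (bOfA (SymRay.aDiag n) 1 + 1)) * coeffW (bOfA (SymRay.aDiag n))) ∧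
      cellularIntegral (SymRay.aDiag n) =
        2 * (rhoOf (SymRay.aDiag n) : ℝ) *
          (((coeffW (Function.update (bOfA (SymRay.aDiag n)) 1 (bOfA (SymRay.aDiag n) 1 + 1)) : ℝ) -
                2 * zetaValue 2 * coeffU (Function.update (bOfA (SymRay.aDiag n)) 1 (bOfA (SymRay.aDiag n) 1 + 1))) *
              vwpDual 7 (bOfA (SymRay.aDiag n)) -
            ((coeffW (bOfA (SymRay.aDiag n)) : ℝ) - 2 * zetaValue 2 * coeffU (bOfA (SymRay.aDiag n))) *
              vwpDual 7 (Function.update (bOfA (SymRay.aDiag n)) 1 (bOfA (SymRay.aDiag n) 1 + 1))) :=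
  SymRay.wedgeDictionary_diag I_solvesRec_holds I_init_holds n

/-! ## 4. On the dictionary's region: the leading coefficient, the approximating form, the shape of (4) -/

/-- **`Q(a) = ρ(a)·M₃(b(a))`** (Brown–Zudilin's leading coefficient (17) is the cell's closed scalar times the `j`-free Casoratian
`M₃`) at every point of the dictionary's region with an admissible partner (was conditional on `wedgeDictionary`). [folklore] -/
theorem Q_eq_rho_mul_quadM3 (a : Fin 8 → ℤ) {j : ℕ} (hj : j ∈ Icc 1 7) (hconv : Converges a)
    (hreg : ∀ i ∈ Icc 1 7, 0 ≤ bOfA a i ∧ 2 * bOfA a i ≤ bOfA a 0 + 1) (hd : 0 ≤ dOf (bOfA a))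
    (hpart : 2 * (bOfA a j + 1) ≤ bOfA a 0 + 1) :
    (QOf a : ℚ) = rhoOf a * quadM3 (bOfA a) :=
  Q_eq_rho_mul_quadM3_of_wedgeDictionary wedgeDictionary_holds a hj hconv hreg hd hpart

/-- **THE APPROXIMATING FORM, hypothesis-free on the region**: `Q(a)·ζ(5) − P(a) = ρ(a)·(W(b′)·F̃₇(b) − W(b)·F̃₇(b′))` with
`P(a) = ρ(W′V − WV′)`, `b = b(a)`, `b′ = b + e_j` (was conditional on `wedgeDictionary`).  An identity of real numbers; no bound on
its size is asserted. [folklore] -/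
theorem approximatingForm (a : Fin 8 → ℤ) {j : ℕ} (hj : j ∈ Icc 1 7) (hconv : Converges a)
    (hreg : ∀ i ∈ Icc 1 7, 0 ≤ bOfA a i ∧ 2 * bOfA a i ≤ bOfA a 0 + 1)
    (hd : 0 ≤ dOf (bOfA a)) (hpart : 2 * (bOfA a j + 1) ≤ bOfA a 0 + 1) :
    (QOf a : ℝ) * zetaValue 5 -
        ((rhoOf a * (coeffW (Function.update (bOfA a) j (bOfA a j + 1)) * coeffV (bOfA a) -
            coeffW (bOfA a) * coeffV (Function.update (bOfA a) j (bOfA a j + 1))) : ℚ) : ℝ) =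
      (rhoOf a : ℝ) * ((coeffW (Function.update (bOfA a) j (bOfA a j + 1)) : ℝ) * vwpDual 7 (bOfA a) -
        (coeffW (bOfA a) : ℝ) * vwpDual 7 (Function.update (bOfA a) j (bOfA a j + 1))) :=
  approximatingForm_of_wedgeDictionary wedgeDictionary_holds a hj hconv hreg hd hpart

/-- The triangle-inequality bound of the approximating form by the two very-well-poised series, hypothesis-free on the region:
`|Q(a)ζ(5) − P(a)| ≤ |ρ|·(|W′|·|F̃₇(b)| + |W|·|F̃₇(b′)|)` (was conditional on `wedgeDictionary`). [folklore] -/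
theorem abs_approximatingForm_le (a : Fin 8 → ℤ) {j : ℕ} (hj : j ∈ Icc 1 7) (hconv : Converges a)
    (hreg : ∀ i ∈ Icc 1 7, 0 ≤ bOfA a i ∧ 2 * bOfA a i ≤ bOfA a 0 + 1)
    (hd : 0 ≤ dOf (bOfA a)) (hpart : 2 * (bOfA a j + 1) ≤ bOfA a 0 + 1) :
    |(QOf a : ℝ) * zetaValue 5 -
        ((rhoOf a * (coeffW (Function.update (bOfA a) j (bOfA a j + 1)) * coeffV (bOfA a) -
            coeffW (bOfA a) * coeffV (Function.update (bOfA a) j (bOfA a j + 1))) : ℚ) : ℝ)| ≤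
      |(rhoOf a : ℝ)| * (|(coeffW (Function.update (bOfA a) j (bOfA a j + 1)) : ℝ)| * |vwpDual 7 (bOfA a)| +
        |(coeffW (bOfA a) : ℝ)| * |vwpDual 7 (Function.update (bOfA a) j (bOfA a j + 1))|) :=
  abs_approximatingForm_le_of_wedgeDictionary wedgeDictionary_holds a hj hconv hreg hd hpart

/-- **The SHAPE of Brown–Zudilin's (4) with leading coefficient (17), hypothesis-free ON THE DICTIONARY'S REGION**: for convergent
`a` with `b(a)` in the half box, `d ≥ 0` and an admissible partner, `∃ P̂ P ∈ ℚ, I(a) = Q(a)(2ζ(5) + 4ζ(3)ζ(2)) − 4P̂ζ(2) − 2P`.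
This is the conclusion of the named Literature fact `BrownZudilin2022.decomposition` RESTRICTED to the region; the fact itself
((4) on the whole convergence cone) is NOT proved here. [folklore] -/
theorem decomposition_on_region (a : Fin 8 → ℤ) {j : ℕ} (hj : j ∈ Icc 1 7) (hconv : Converges a)
    (hreg : ∀ i ∈ Icc 1 7, 0 ≤ bOfA a i ∧ 2 * bOfA a i ≤ bOfA a 0 + 1)
    (hd : 0 ≤ dOf (bOfA a)) (hpart : 2 * (bOfA a j + 1) ≤ bOfA a 0 + 1) :
    ∃ Phat P : ℚ, cellularIntegral a =
      (QOf a : ℝ) * (2 * zetaValue 5 + 4 * zetaValue 3 * zetaValue 2) -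
        4 * (Phat : ℝ) * zetaValue 2 - 2 * (P : ℝ) :=
  decomposition_shape_of_wedgeDictionary wedgeDictionary_holds a hj hconv hreg hd hpart

/-! ## 5. The generator `i₁` -/

/-- **`I(i₁ a) = I(a)`** for every convergent `a` (Brown–Zudilin's generator `i₁ = (14)(23)(57)` of `G` preserves convergence and the
factorial normaliser of (27)), from the theorem (27) at `i₁` (was conditional on `invariance_of_converges'`). [folklore] -/
theorem cellularIntegral_genI1_eq {a : Fin 8 → ℤ} (h : Converges a) : cellularIntegral (genI1 a) = cellularIntegral a :=
  cellularIntegral_genI1 invariance_of_converges'_holds h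

end Summit.KontsevichZagierPeriods.Zeta5Search.WedgeDictionaryClosingConsequences
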